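import Summits.QuantumFields.BalabanUV.Beta.FP.TowerDoorGaugeRefDefsG
import Summits.QuantumFields.BalabanUV.Beta.FP.TowerDoorGaugeCopies

/-!
# `BalabanUV.Beta.FP.TowerDoorGaugeCopiesG` — row D1 ∕ (C1) OWNER «beta-an2», PART 82, ROUTE T (β1), v11 (R-root): **ONE COPY, OVER `Q`** — PART 56 `TowerDoorGaugeCopies` §3's
# `treeGauge_readout_eq_neg_lamZ` (the `hlve` word of a copy's gauge parameter on the box `M` is `−λℤ`) re-typed ONCE over an abstract step-row family `Q : StepRows d Lc` under the road's displayed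
# letters (TB)(TQ) (`hQ₁₀ : Q₁₀ = compRowsG Lc Q M lev rs (n+1)`, `lamZ ↦ lamZG Lc Q`), then DISCHARGED at the ROOTED record (`hQ₁₀ : Q₁₀ = compRows Lc M lev (fun _ => ctrOff (d+1) Lc) (n+1)`, PART 80's
# `QCtr_twoBlock ∕ QCtr_blockTranslate ∕ compRows_ctr_eq_compRowsG`) — PART 56's §1–§2 (the `HasSum` bookkeeping, the copies of one source) are row-free and are REUSED by name downstream
# (β-function cell `pub-balaban`, BINDER-OWNERS row D1; FINDING AN2-82-1, road A-4 l.69064)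

WHY (located).  PART 56 §3 reads road (C6) `TorusReferenceBlock.treeGauge_readout_eq_reference`, which is `QstepSymBlockTranslate.treeGauge_readout_corr_sym` — the (0.4)-SYM rows with (TB)(TQ)
discharged at `QSym Lc`.  The road's part 4 `TorusNestedReadoutReference.treeGauge_readout_corr` is GENERIC in `Q` under (TB)(TQ) displayed; this file composes it with PART 81's `refSliceG ∕
refThetaG ∕ lamZG` exactly as (C6) + PART 56 compose the sym letters (reference torus `M′ := fun _ => Lc`, shift `v := −quo L ↑s`, `s′ := ↑s − L•quo L ↑s` by (C6) §1 `sub_zsmul_quo_mem_pbox_ref`,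
the column agreement from the chart's `L`-block covariance `hA`).

WHAT ([folklore] BY NAME; no `def`, no `def … : Prop`, nothing cited, 0 sorry): §1 **`treeGauge_readout_eq_neg_lamZG`** (generic `Q`, (TB)(TQ) displayed as `hQ hQt` in the road's texts);
§2 **`treeGauge_readout_eq_neg_lamZG_rooted`** (the rooted record at the constant centred root list, (TB)(TQ) discharged by PART 80; `lamZG` at the centred rooted family).
WHAT THIS IS NOT: not the periodisation identity (PART 57′); nothing of v10 ∕ the END of record moves; nothing of Bałaban's asserted, valued or discharged; 0 estimates; 0∕4 row-D1 binders
(hW, hR, D1Tel, D1Rep); ROOT M‴ p325680 ∕ P5c ∕ D6 untouched; NOT (C1), NOT (T-ID), NOT D1, NEVER «G-an2-4 closed», NOT BetaPertH, NOT continuum, NOT Clay.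

HONEST DEPENDENCY (page 1, mandatory): continuum YM on T⁴ ⇐ BetaPertH ∧ nine spine estimates (0/9 proved); BetaPertH ⇐ (D1) ∧ (D4) ∧ CAP+tail;
G-an2-4 gates asym, D1 and NE2/3/4.  HONEST FRAMING (cell contract, verbatim): «discharging `BetaPertH` makes Bałaban's UV stability UNCONDITIONAL —
a real constructive-QFT result; it is NOT the continuum limit and NOT the Clay problem.»  ABSOLUTE RULE (cell charter, verbatim): «No internally-minted
statement may enter as a cited fact. Every hypothesis is either kernel-proved in this package or a verbatim quotation of a PUBLISHED theorem with page
reference. The manuscript(s) under audit are NOT citable for their own disputed steps — they are the thing under adjudication; programme-internal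
(2001/route/tribunal) claims are never citable.»  Row D1 ∕ (C1) OWNER «beta-an2», b2b-balaban-beta-an2 gen 82, 2026-08-29.  No existing file touched.
-/

noncomputable section

open Finset Matrix
open scoped BigOperators
open Literature.MathematicalPhysics.QuantumFieldTheory
open Literature.MathematicalPhysics.QuantumFieldTheory.Balaban1983to89
open Literature.MathematicalPhysics.QuantumFieldTheory.Balaban1983to89.Beta
open B5Prop11Plancherel (fine)
open B6Lemma24Torus (pbox)
open AffineAveraging (Site box toSite unitVec)
open AveragingContoursRooted (ctrOff ctrOff_mem_box)
open OneStepResolventKernel (Fib)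
open ExpKernelCalculus (MKer shiftK)
open Literature.MathematicalPhysics.QuantumFieldTheory.LatticeForm (quo)
open Summit.QuantumFields.BalabanUV.Beta.FP.KernelPeriodisationFib (Idx)
open Summit.QuantumFields.BalabanUV.Beta.FP.TorusCombRows (Res)
open Summit.QuantumFields.BalabanUV.Beta.FP.TorusCompositeObjects (towerTorus Qstep NParam combF bigP towerGen compRows bigRoot bigRatio towerEquiv)
open Summit.QuantumFields.BalabanUV.Beta.FP.TorusCompositeObjectsG (StepRows compRowsG)
open Summit.QuantumFields.BalabanUV.Beta.FP.TorusCompositeUnimodular (towerEvalC)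
open Summit.QuantumFields.BalabanUV.Beta.GAN24.FineReadoutCauchyFrame (toSite_mem_range)
open Summit.QuantumFields.BalabanUV.Beta.FP.TorusReferenceBlock (sub_zsmul_quo_mem_pbox_ref)
open Summit.QuantumFields.BalabanUV.Beta.FP.TorusNestedReadoutReference (treeGauge_readout_corr)
open Summit.QuantumFields.BalabanUV.Beta.FP.TowerDoorGaugeRefDefs (refCol refCol_apply)
open Summit.QuantumFields.BalabanUV.Beta.FP.TowerDoorGaugeRefDefsG
open Summit.QuantumFields.BalabanUV.Beta.FP.QstepCtrTwoBlock (QCtr_twoBlock QCtr_blockTranslate compRows_ctr_eq_compRowsG)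

namespace Summit.QuantumFields.BalabanUV.Beta.FP.TowerDoorGaugeCopiesG

variable {d : ℕ}

/-! ## §1 One copy over `Q`, (TB)(TQ) displayed -/

section Generic

variable (Lc : ℕ) [NeZero Lc] (Q : StepRows d Lc)
  (hQ : ∀ (M : Fin (d + 1) → ℕ) [∀ μ, NeZero (M μ)] (ℓ : ℕ) (r : Fin (d + 1) → ℕ) (a : ↥(pbox M)) (ν : Fin (d + 1))
      (b : ↥(pbox (fine Lc M))) (κ : Fin (d + 1)),
      (a : Site (d + 1)) + unitVec ν ∈ pbox M → Q M ℓ r (a, ν) (b, κ) ≠ 0 →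
        (quo Lc (b : Site (d + 1)) = a ∨ quo Lc (b : Site (d + 1)) = (a : Site (d + 1)) + unitVec ν) ∧
        (quo Lc ((b : Site (d + 1)) + unitVec κ) = a ∨ quo Lc ((b : Site (d + 1)) + unitVec κ) = (a : Site (d + 1)) + unitVec ν))
  (hQt : ∀ (M M' : Fin (d + 1) → ℕ) [∀ μ, NeZero (M μ)] [∀ μ, NeZero (M' μ)] (ℓ : ℕ) (r : Fin (d + 1) → ℕ) (v : Site (d + 1))
      (a : ↥(pbox M)) (a' : ↥(pbox M')) (ν : Fin (d + 1)) (b : ↥(pbox (fine Lc M))) (b' : ↥(pbox (fine Lc M'))) (κ : Fin (d + 1)),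
      (a' : Site (d + 1)) = (a : Site (d + 1)) + (Lc : ℤ) • v → (b' : Site (d + 1)) = (b : Site (d + 1)) + (Lc : ℤ) • ((Lc : ℤ) • v) →
      (a : Site (d + 1)) + unitVec ν ∈ pbox M → (a' : Site (d + 1)) + unitVec ν ∈ pbox M' →
        Q M ℓ r (a, ν) (b, κ) = Q M' ℓ r (a', ν) (b', κ))
  (M : Fin (d + 1) → ℕ) [∀ μ, NeZero (M μ)] (lev : ℕ → ℕ) (rs : ℕ → (Fin (d + 1) → ℕ))
  (hrs : ∀ k i, 0 ≤ toSite (rs k) i ∧ toSite (rs k) i < (Lc : ℤ)) (hM : ∀ i, Lc ∣ M i) (n : ℕ)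
include hQ hQt hM

/-- [folklore] **`treeGauge_readout_eq_neg_lamZG` — ONE COPY, OVER `Q`**: at the wrapper's letters on the box `M` with `Q₁₀ = compRowsG Lc Q M lev rs (n+1)` (G-2's `det ≠ 0` displayed on the box
AND on the reference tower), for an `L`-block covariant kernel `A`, if `θ` solves `(N·W₀)·θ = −N·X_z` for the lattice column `X_z b = A ↑b.1 (L•z) (inl b.2) (inr μ)`, then its `hlve` word at the
finest site `s` is `−lamZG Lc Q lev rs hrs n A μ z ↑s` — road `treeGauge_readout_corr` (generic, (TB)(TQ) displayed) at the reference torus with `X′ := refCol … (z − quo L ↑s)`, `θ′ := refThetaG …`. -/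
theorem treeGauge_readout_eq_neg_lamZG
    {Q₁₀ : Matrix (↥(pbox M) × Fin (d + 1)) (↥(pbox (towerTorus Lc M (n + 1))) × Fin (d + 1)) ℝ} (hQ₁₀ : Q₁₀ = compRowsG Lc Q M lev rs (n + 1))
    {τ₁ : Matrix (NParam Lc (fine Lc M) (fun k => rs (k + 1)) n) (↥(pbox (towerTorus Lc M (n + 1))) × Fin (d + 1)) ℝ}
    (hτ₁ : τ₁ = bigP Lc (fine Lc M) (fun k => rs (k + 1)) (fun k => hrs (k + 1)) n)
    {τ₂ : Matrix (Res (toSite (rs 0)) Lc M) (↥(pbox M) × Fin (d + 1)) ℝ} (hτ₂ : τ₂ = combF Lc M (rs 0))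
    {N : Matrix (NParam Lc M rs (n + 1)) (↥(pbox (towerTorus Lc M (n + 1))) × Fin (d + 1)) ℝ} (hN : N = Matrix.fromRows (τ₂ * Q₁₀) τ₁)
    {W₀ : Matrix (↥(pbox (towerTorus Lc M (n + 1))) × Fin (d + 1)) (NParam Lc M rs (n + 1)) ℝ} (hW₀ : W₀ = towerGen Lc M rs (n + 1))
    {E : Matrix (NParam Lc M rs (n + 1)) (NParam Lc M rs (n + 1)) ℝ} (hE : E = towerEvalC Lc M rs hrs (n + 1))
    (hTW : (N * W₀).det ≠ 0)
    (hTW' : (refSliceG Lc Q lev rs hrs n * towerGen Lc (fun _ : Fin (d + 1) => Lc) rs (n + 1)).det ≠ 0)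
    (A : MKer (d + 1) (Fib d)) (hA : ∀ t : Site (d + 1), shiftK (-(((bigRatio Lc (n + 1) : ℕ) : ℤ) • t)) A = A)
    (μ : Fin (d + 1)) (z : Site (d + 1)) {θ : NParam Lc M rs (n + 1) → ℝ}
    (hθ : (N * W₀) *ᵥ θ = -(N *ᵥ fun b : ↥(pbox (towerTorus Lc M (n + 1))) × Fin (d + 1) =>
      A (b.1 : Site (d + 1)) (((bigRatio Lc (n + 1) : ℕ) : ℤ) • z) (Sum.inl b.2) (Sum.inr μ)))
    (s : ↥(pbox (towerTorus Lc M (n + 1)))) :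
    (∑ x : Res (bigRoot Lc rs (n + 1)) (bigRatio Lc (n + 1)) (towerTorus Lc M (n + 1)),
        (if (x.1 : ↥(pbox (towerTorus Lc M (n + 1)))) = s then (E *ᵥ θ) (towerEquiv Lc M rs hrs (n + 1) x) else 0))
      = -lamZG Lc Q lev rs hrs n A μ z (s : Site (d + 1)) := by
  rw [lamZG_eq, neg_neg]
  exact treeGauge_readout_corr Lc Q hQ hQt M (fun _ : Fin (d + 1) => Lc) lev rs hrs hM (fun _ => dvd_rfl) n
    (-quo (bigRatio Lc (n + 1)) (s : Site (d + 1)))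
    hQ₁₀ hτ₁ hτ₂ hN hW₀ hE rfl rfl rfl (refSliceG_eq Lc Q lev rs hrs n) rfl rfl hTW hTW' hθ
    (refSliceG_mul_towerGen_mulVec_refThetaG Lc Q lev rs hrs n A hTW' μ (z - quo (bigRatio Lc (n + 1)) (s : Site (d + 1)))) s _ rfl
    (fun b b' h1 h2 _ _ => by
      have e := congrFun (congrFun (congrFun (congrFun (hA (quo (bigRatio Lc (n + 1)) (s : Site (d + 1)))) (b.1 : Site (d + 1)))
        (((bigRatio Lc (n + 1) : ℕ) : ℤ) • z)) (Sum.inl b.2)) (Sum.inr μ)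
      rw [refCol_apply, h1, h2, ← e]
      simp only [shiftK, smul_add, smul_neg, sub_eq_add_neg])

end Generic

/-! ## §2 One copy AT THE ROOTED RECORD (constant centred root list; (TB)(TQ) discharged by PART 80) -/

section Rooted

variable (Lc : ℕ) [NeZero Lc] (M : Fin (d + 1) → ℕ) [∀ μ, NeZero (M μ)] (lev : ℕ → ℕ)
  (hrs : ∀ k i, 0 ≤ toSite ((fun _ : ℕ => ctrOff (d + 1) Lc) k) i ∧ toSite ((fun _ : ℕ => ctrOff (d + 1) Lc) k) i < (Lc : ℤ)) (hM : ∀ i, Lc ∣ M i) (n : ℕ)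
include hM

/-- [folklore] **`treeGauge_readout_eq_neg_lamZG_rooted` — ONE COPY AT THE ROOTED RECORD**: §1 at the centred rooted family with `hQ₁₀ : Q₁₀ = compRows Lc M lev (fun _ => ctrOff (d+1) Lc) (n+1)`
(v11's `hQ₁₀′` text, root list of record); the gauge function is `lamZG` at `fun M _ ℓ _ => Qstep Lc M ℓ (ctrOff (d+1) Lc)`. -/
theorem treeGauge_readout_eq_neg_lamZG_rooted
    {Q₁₀ : Matrix (↥(pbox M) × Fin (d + 1)) (↥(pbox (towerTorus Lc M (n + 1))) × Fin (d + 1)) ℝ}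
    (hQ₁₀ : Q₁₀ = compRows Lc M lev (fun _ : ℕ => ctrOff (d + 1) Lc) (n + 1))
    {τ₁ : Matrix (NParam Lc (fine Lc M) (fun k => (fun _ : ℕ => ctrOff (d + 1) Lc) (k + 1)) n) (↥(pbox (towerTorus Lc M (n + 1))) × Fin (d + 1)) ℝ}
    (hτ₁ : τ₁ = bigP Lc (fine Lc M) (fun k => (fun _ : ℕ => ctrOff (d + 1) Lc) (k + 1)) (fun k => hrs (k + 1)) n)
    {τ₂ : Matrix (Res (toSite ((fun _ : ℕ => ctrOff (d + 1) Lc) 0)) Lc M) (↥(pbox M) × Fin (d + 1)) ℝ} (hτ₂ : τ₂ = combF Lc M ((fun _ : ℕ => ctrOff (d + 1) Lc) 0))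
    {N : Matrix (NParam Lc M (fun _ : ℕ => ctrOff (d + 1) Lc) (n + 1)) (↥(pbox (towerTorus Lc M (n + 1))) × Fin (d + 1)) ℝ} (hN : N = Matrix.fromRows (τ₂ * Q₁₀) τ₁)
    {W₀ : Matrix (↥(pbox (towerTorus Lc M (n + 1))) × Fin (d + 1)) (NParam Lc M (fun _ : ℕ => ctrOff (d + 1) Lc) (n + 1)) ℝ}
    (hW₀ : W₀ = towerGen Lc M (fun _ : ℕ => ctrOff (d + 1) Lc) (n + 1))
    {E : Matrix (NParam Lc M (fun _ : ℕ => ctrOff (d + 1) Lc) (n + 1)) (NParam Lc M (fun _ : ℕ => ctrOff (d + 1) Lc) (n + 1)) ℝ}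
    (hE : E = towerEvalC Lc M (fun _ : ℕ => ctrOff (d + 1) Lc) hrs (n + 1))
    (hTW : (N * W₀).det ≠ 0)
    (hTW' : (refSliceG Lc (fun (M : Fin (d + 1) → ℕ) (_ : ∀ μ, NeZero (M μ)) (ℓ : ℕ) (_ : Fin (d + 1) → ℕ) => Qstep Lc M ℓ (ctrOff (d + 1) Lc)) lev
        (fun _ : ℕ => ctrOff (d + 1) Lc) hrs n * towerGen Lc (fun _ : Fin (d + 1) => Lc) (fun _ : ℕ => ctrOff (d + 1) Lc) (n + 1)).det ≠ 0)
    (A : MKer (d + 1) (Fib d)) (hA : ∀ t : Site (d + 1), shiftK (-(((bigRatio Lc (n + 1) : ℕ) : ℤ) • t)) A = A)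
    (μ : Fin (d + 1)) (z : Site (d + 1)) {θ : NParam Lc M (fun _ : ℕ => ctrOff (d + 1) Lc) (n + 1) → ℝ}
    (hθ : (N * W₀) *ᵥ θ = -(N *ᵥ fun b : ↥(pbox (towerTorus Lc M (n + 1))) × Fin (d + 1) =>
      A (b.1 : Site (d + 1)) (((bigRatio Lc (n + 1) : ℕ) : ℤ) • z) (Sum.inl b.2) (Sum.inr μ)))
    (s : ↥(pbox (towerTorus Lc M (n + 1)))) :
    (∑ x : Res (bigRoot Lc (fun _ : ℕ => ctrOff (d + 1) Lc) (n + 1)) (bigRatio Lc (n + 1)) (towerTorus Lc M (n + 1)),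
        (if (x.1 : ↥(pbox (towerTorus Lc M (n + 1)))) = s then (E *ᵥ θ) (towerEquiv Lc M (fun _ : ℕ => ctrOff (d + 1) Lc) hrs (n + 1) x) else 0))
      = -lamZG Lc (fun (M : Fin (d + 1) → ℕ) (_ : ∀ μ, NeZero (M μ)) (ℓ : ℕ) (_ : Fin (d + 1) → ℕ) => Qstep Lc M ℓ (ctrOff (d + 1) Lc)) lev
          (fun _ : ℕ => ctrOff (d + 1) Lc) hrs n A μ z (s : Site (d + 1)) := by
  rw [compRows_ctr_eq_compRowsG] at hQ₁₀
  exact treeGauge_readout_eq_neg_lamZG Lc _ (QCtr_twoBlock Lc) (QCtr_blockTranslate Lc) M lev (fun _ : ℕ => ctrOff (d + 1) Lc) hrs hM n hQ₁₀ hτ₁ hτ₂ hN hW₀ hE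
    hTW hTW' A hA μ z hθ s

end Rooted

end Summit.QuantumFields.BalabanUV.Beta.FP.TowerDoorGaugeCopiesG

end
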